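import Summits.CriticalPhenomena.PercolationContinuityZ3.Theorems.Transplant.SkelPhiWinStep
import Summits.CriticalPhenomena.PercolationContinuityZ3.Theorems.Transplant.SkelKitResiduesHab
import HarnessLib

/-!
# D″ node, STRUCTURE-FREE generic layer (SHEAR-SCOPE §3.14 ruling (B″), V98; DPRIME-SCOPE L6′/L7′): the FACE RESIDUE of the generic node for
# a bare planar map `φ : V → ℤ²` — `Skelφ.FaceOblAt` / `Skelφ.FaceOblR` (one window step `Skelφ.tstep G φ P` per face of every RUN history of a
# lag-1 anchored scheme `S : KSchA V A`), `cond_of_faceOblAt`, and the node-facing combination **`Skelφ.kitAtRun_of_oblRH`** (root residue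
# `Skel.RootOblT` + face residue + habitat corridor residue `Skel.ReachOblRH` ⟹ p5-g3's `KSchA.KitAtRun G S FD δ₂ ε''`) — φ-level re-cut of
# the Φ-DEPENDENT declarations of `SkelKitResidues` (the face part, stmt-g7 p234400) ∪ `SkelKitResiduesHab` (`Skel.kitAtRun_of_oblRH`, stmt-g7);
# the Φ-FREE residues `Skel.RootOblT`, `Skel.ReachOblAtH/ReachOblRH`, `Skel.nmaxC` and the packagings `Skel.rootObl_of_rootOblT`,
# `Skel.reach_of_reachOblAtH` are IMPORTED, not re-declared

builds on p205010 (kernel theorem, internal audit signed; external expert review pending) — nothing in this file uses p205010.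
Lane `prim-bschramm`, seat `prim-hp-8` (gen 30; claim 2026-08-21T04:3xZ — cell-free window-STEP sub-layer of the unowned stmt column); helper
file (`--supports stmt-CriticalPhenomena-4575`).  Hypotheses through p3-g7's dictionary (DPRIME-SCOPE addendum K): `hlip : Skelφ.Lip G φ` only
(through `Skelφ.cond_of_winStep`); the residues take `G φ` explicitly (K2.1); `[DecidableEq V] [Countable V]` section binders as in the source.
The plain-window corridor residue `Skel.ReachOblAt/ReachOblR` (uninhabitable for the cell geometry of record, SHEAR-SCOPE §2.6) is not re-cut.
* §1 **`Skelφ.FaceOblAt G φ S FD Δ' δ₂ h e a a' du j o`** (`∃ (P : WinStepData V) T' η`: the hypotheses of `Skelφ.cond_of_winStep` minus the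
  one-step property and the source bound, regions read as `Skelφ.stepRg G φ P`, levels as `Skelφ.winLData G φ …` / `Skelφ.stepLv G φ P`),
  **`Skelφ.FaceOblR G φ S FD Δ' δ₂`** (run histories, chosen edge, onward `du`, `j < K`, `o`, anchors `(aOf₁, aOf₂)`);
* §2 **`cond_of_faceOblAt (hlip)`**, **`kitAtRun_of_oblRH (hlip)`** (`δc ≤ δ`, the one-step property at `(δ₂ ↦ δc/2)` for the window graphs,
  the chain properties of every length `n ≤ nmaxC` at `(δ ↦ ε'')` for the habitat window graphs and of every length at `(δr n ↦ δc)` for the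
  window graphs, `RootOblT … δr`, `FaceOblR … δ₂`, `ReachOblRH … δ` ⟹ `KitAtRun G S FD δ₂ ε''`);
* §3 bridges (`Iff.rfl`): `Skel.faceOblAt_iff_skelφ`, `Skel.faceOblR_iff_skelφ`.
Call sites port by `Skel.FaceOblAt Φ ↦ Skelφ.FaceOblAt G φ`, `Skel.FaceOblR Φ ↦ Skelφ.FaceOblR G φ`, `cond_of_faceOblAt ↦ cond_of_faceOblAt hlip`,
`kitAtRun_of_oblRH ↦ kitAtRun_of_oblRH hlip` (K2.2).
[cite: KozmaNitzan2024, §4 (30), (32) (pp. 27–28), Lemma 10 (p. 17), Lemmas 11–12 (pp. 22–25), p. 30 (Steps III–IV)]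
-/

noncomputable section

open MeasureTheory ProbabilityTheory
open scoped ENNReal Classical

namespace Summit.CriticalPhenomena.PercolationContinuityZ3.Theorems.Transplant

namespace Skelφ

open Literature.Probability.Percolation Literature.Probability.LatticeModels SimpleGraph KNCells
open GadgetSystem ProbeHistory HSiteScheme Contour
open Skel (winGraph winGraphIn WinStepData RootOblT ReachOblRH nmaxC)

variable {V : Type} [DecidableEq V] [Countable V] (G : SimpleGraph V) [G.LocallyFinite] (φ : V → Site 2)
variable {A : Type*}

/-! ## §1 The face residue -/

/-- **The face obligation at one face** `(h, e, a, a', du, j, o)` for the planar map `φ`: a window step `P` rooted (and centred) at the scheme's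
root whose first level contains `F^{j+1}`, with the subbox / support facts of the law `Wt`, Step II's count at accuracy `δ₂`, the per-level kit
clause at accuracy `δ₂`, a true target `T' ⊆ M^{a'}_{x+du}` inside the enlarged target and the rim excess `≤ η ≤ δc/2` — the hypotheses of
`Skelφ.cond_of_winStep` except the generic one-step property and the source bound (φ-level form of `Skel.FaceOblAt`). [this work] -/
def FaceOblAt (S : KSchA V A) (FD : FaceData V A) (Δ' : ℕ) (δ₂ : ℝ) (h : ProbeHistory V) (e : Site 2 × MDir) (a a' : A) (du : MDir)
    (j : ℕ) (o : Finset (Sym2 V)) : Prop :=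
  ∃ (P : WinStepData V) (T' : Finset V) (η : ℝ),
    P.root = S.Γ.root ∧
    KNLevels.IsSubbox (winGraph G P.root P.Rπ) (S.Wt G h e a a' du j o) S.p (stepRg G φ P) ∧
    KNLevels.FinSupp (S.Wt G h e a a' du j o) P.Sfin ∧ stepRg G φ P ⊆ P.Sfin ∧
    Finset.Icc (P.lo - ((P.Rlev + 1 : ℕ) : Site 2)) (P.hi + ((P.Rlev + 1 : ℕ) : Site 2)) ⊆ P.Dpl ∧
    P.root ∉ stepRg G φ P ∧ P.root ∈ P.Sfin ∧ P.j₁ ≤ P.Rlev ∧ P.T ⊆ stepRg G φ P ∧ P.T.Nonempty ∧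
    1 / (1 - (S.p : ℝ)) ^ (Δ' * P.N) ≤ δ₂ * ((Finset.Icc P.j₀ P.j₁).card : ℝ) ∧
    (∀ j' ∈ Finset.Icc P.j₀ P.j₁, ∃ (σ : KNLevels.SData V) (Sz : Finset V),
      KNLevels.SHyp (winLData G φ P.root P.Rπ P.lo P.hi P.root P.Sfin) j' σ ∧ σ.N ≤ P.N ∧
      (1 - (S.p : ℝ) ^ σ.sB) ^ σ.k ≤ δ₂ ∧ Sz ⊆ (winLData G φ P.root P.Rπ P.lo P.hi P.root P.Sfin).X j' ∧ Sz ⊆ stepRg G φ P ∧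
      (∀ x ∈ σ.K, ∀ e' ∈ σ.seed x, e' ∉ wireSet (↑Sz : Set V)) ∧ (∀ x ∈ σ.K, σ.face x ⊆ Sz) ∧
      (∀ x ∈ σ.K, 1 - 3 * δ₂ ≤ (prodBernoulli (S.Wt G h e a a' du j o)).real {ω | ∃ u ∈ σ.face x,
        1 - δ₂ < (prodBernoulli (pinW (S.Wt G h e a a' du j o) (wireSet (↑Sz : Set V)) ω)).real
          (⋃ t ∈ P.T, openConnIn (↑(stepRg G φ P) : Set V) u t)})) ∧
    T' ⊆ P.T ∧ T' ⊆ S.Γ.M a' (tgt e + stepVec du) ∧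
    (prodBernoulli (S.Wt G h e a a' du j o)).real (⋃ t ∈ P.T \ T', openConn S.Γ.root t) ≤ η ∧ η ≤ S.δc / 2 ∧
    FD.Face a' (tgt e) du (j + 1) ⊆ (stepLv G φ P).X 0

/-- **The face obligations, run-restricted form** for the planar map `φ`: `FaceOblAt` for every RUN history whose chosen candidate is `e`, valid,
every onward direction, every `j < K` and every `o`, at the history anchors `(aOf₁, aOf₂)` (φ-level form of `Skel.FaceOblR`). [this work] -/
def FaceOblR (S : KSchA V A) (FD : FaceData V A) (Δ' : ℕ) (δ₂ : ℝ) : Prop :=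
  ∀ h e, S.IsRun₂ G h → (S.astOf₂ G h).st.choice = some e → S.Valid₂ G h e →
    ∀ du ∈ S.onward G h (tgt e), ∀ j < S.Γ.K, ∀ o : Finset (Sym2 V),
      FaceOblAt G φ S FD Δ' δ₂ h e (S.aOf₁ G h e) (S.aOf₂ G h e) du j o

/-! ## §2 The packaging: `cond` from the face residue; the run-restricted obligations from the three residues -/

variable {G φ}
variable {S : KSchA V A} {FD : FaceData V A}
variable {h : ProbeHistory V} {e : Site 2 × MDir} {a a' : A} {du : MDir}

omit [Countable V] in
/-- **`FaceOblAt` + the one-step property at `(δ₂ ↦ δc/2)` for every window graph + the source bound ⟹ `cond`** (`Skelφ.cond_of_winStep`, from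
`Lip`). [cite: KozmaNitzan2024, §4 p. 30 (Step III), Lemma 10 (p. 17)] -/
theorem cond_of_faceOblAt (hlip : Lip G φ) {Δ' : ℕ} {δ₂ : ℝ} {j : ℕ} {o : Finset (Sym2 V)}
    (hstep : ∀ (c : V) (Rπ : ℕ) (Wg : Sym2 V → unitInterval) (s : KNLevels.TStep (winGraph G c Rπ)), s.KitsAt Wg S.p Δ' δ₂ →
      1 - δ₂ < (prodBernoulli Wg).real s.L.reachB → 1 - S.δc / 2 < (prodBernoulli Wg).real (⋃ t ∈ s.T, openConn s.L.o t))
    (hF : FaceOblAt G φ S FD Δ' δ₂ h e a a' du j o)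
    (hsrc : 1 - δ₂ < (prodBernoulli (S.Wt G h e a a' du j o)).real (⋃ b ∈ FD.Face a' (tgt e) du (j + 1), openConn S.Γ.root b)) :
    S.cond G h e a a' du j o := by
  obtain ⟨P, T', η, hroot, hsub, hfin, hDS, hencl, ho, hoS, hj, hTD, hTne, hcount, hkits, hT', hT'M, hexc, hη, hface⟩ := hF
  exact cond_of_winStep hlip P (hstep P.root P.Rπ) hroot hsub hfin hDS hencl ho hoS hj hTD hTne hcount hkits T' hT' hT'M hexc hη hface hsrc

/-- **The run-restricted obligations from the named residues, habitat form** (from `Lip`): `δc ≤ δ`, the one-step property at `(δ₂ ↦ δc/2)` for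
the window graphs, the chain properties of every length `n ≤ nmaxC` at `(δ ↦ ε'')` for the habitat window graphs, the chain properties of every
length at `(δr n ↦ δc)` for the window graphs, `Skel.RootOblT … δr`, `Skelφ.FaceOblR … δ₂` and `Skel.ReachOblRH … δ` ⟹ p5-g3's
`KitAtRun G S FD δ₂ ε''` (φ-level form of `Skel.kitAtRun_of_oblRH`). [cite: KozmaNitzan2024, §4 (30), (32), Lemmas 10–12] -/
theorem kitAtRun_of_oblRH (hlip : Lip G φ) {Δ' : ℕ} {δ δ₂ ε'' : ℝ} {δr : ℕ → ℝ} (hδc : S.δc ≤ δ)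
    (hstep : ∀ (c : V) (Rπ : ℕ) (Wg : Sym2 V → unitInterval) (s : KNLevels.TStep (winGraph G c Rπ)), s.KitsAt Wg S.p Δ' δ₂ →
      1 - δ₂ < (prodBernoulli Wg).real s.L.reachB → 1 - S.δc / 2 < (prodBernoulli Wg).real (⋃ t ∈ s.T, openConn s.L.o t))
    (hchain : ∀ n ≤ nmaxC, ∀ (Ω : Finset V) (Wg : Sym2 V → unitInterval) (s : Fin (n + 1) → KNLevels.TStep (winGraphIn G Ω))
      (T' : Fin (n + 1) → Finset V) (η : ℝ),
      (∀ i : Fin (n + 1), (s i).L.o = (s 0).L.o) →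
      (∀ i : Fin n, T' (Fin.castSucc i) ⊆ (s i.succ).L.X 0) →
      (∀ i : Fin (n + 1), T' i ⊆ (s i).T) →
      (∀ i : Fin (n + 1), (s i).KitsAt Wg S.p Δ' δ) →
      η ≤ δ / 2 →
      (∀ i : Fin (n + 1), (prodBernoulli Wg).real (⋃ t ∈ (s i).T \ T' i, openConn (s 0).L.o t) ≤ η) →
      1 - δ < (prodBernoulli Wg).real (s 0).L.reachB →
        1 - ε'' < (prodBernoulli Wg).real (⋃ t ∈ T' (Fin.last n), openConn (s 0).L.o t))
    (hchainr : ∀ (n : ℕ) (c : V) (Rπ : ℕ) (Wg : Sym2 V → unitInterval) (s : Fin (n + 1) → KNLevels.TStep (winGraph G c Rπ))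
      (T' : Fin (n + 1) → Finset V) (η : ℝ),
      (∀ i : Fin (n + 1), (s i).L.o = (s 0).L.o) →
      (∀ i : Fin n, T' (Fin.castSucc i) ⊆ (s i.succ).L.X 0) →
      (∀ i : Fin (n + 1), T' i ⊆ (s i).T) →
      (∀ i : Fin (n + 1), (s i).KitsAt Wg S.p Δ' (δr n)) →
      η ≤ δr n / 2 →
      (∀ i : Fin (n + 1), (prodBernoulli Wg).real (⋃ t ∈ (s i).T \ T' i, openConn (s 0).L.o t) ≤ η) →
      1 - δr n < (prodBernoulli Wg).real (s 0).L.reachB →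
        1 - S.δc < (prodBernoulli Wg).real (⋃ t ∈ T' (Fin.last n), openConn (s 0).L.o t))
    (hQ0 : RootOblT G S Δ' δr) (hface : FaceOblR G φ S FD Δ' δ₂) (hreach : ReachOblRH G S FD Δ' δ) :
    KSchA.KitAtRun G S FD δ₂ ε'' := by
  refine And.intro (Skel.rootObl_of_rootOblT hchainr hQ0) (And.intro ?_ ?_)
  · intro h e hrun hc hV du hdu j hj o hsrc
    exact cond_of_faceOblAt hlip hstep (hface h e hrun hc hV du hdu j hj o) hsrc
  · intro h e hrun hc hV du hdu
    exact Skel.reach_of_reachOblAtH hV hδc hchain (hreach h e hrun hc hV du hdu)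

end Skelφ

/-! ## §3 Bridges: the structure-level face residue is the φ-level one (by `Iff.rfl`) -/

namespace Skel

open Literature.Probability.Percolation Literature.Probability.LatticeModels KNCells
open GadgetSystem ProbeHistory HSiteScheme Contour

variable {V : Type} [DecidableEq V] [Countable V] {G : SimpleGraph V} [G.LocallyFinite] (Φ : PlanarSkeletonConc G) {A : Type*}

omit [Countable V] in
/-- `Skel.FaceOblAt Φ` is the φ-level `Skelφ.FaceOblAt G Φ.φ`. [folklore] -/
theorem faceOblAt_iff_skelφ (S : KSchA V A) (FD : FaceData V A) (Δ' : ℕ) (δ₂ : ℝ) (h : ProbeHistory V) (e : Site 2 × MDir) (a a' : A)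
    (du : MDir) (j : ℕ) (o : Finset (Sym2 V)) :
    FaceOblAt Φ S FD Δ' δ₂ h e a a' du j o ↔ Skelφ.FaceOblAt G Φ.φ S FD Δ' δ₂ h e a a' du j o := Iff.rfl

omit [Countable V] in
/-- `Skel.FaceOblR Φ` is the φ-level `Skelφ.FaceOblR G Φ.φ`. [folklore] -/
theorem faceOblR_iff_skelφ (S : KSchA V A) (FD : FaceData V A) (Δ' : ℕ) (δ₂ : ℝ) :
    FaceOblR Φ S FD Δ' δ₂ ↔ Skelφ.FaceOblR G Φ.φ S FD Δ' δ₂ := Iff.rfl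

end Skel

end Summit.CriticalPhenomena.PercolationContinuityZ3.Theorems.Transplant

end
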